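import Literature.Algebra.Homology.EulerCharacteristicShortExact
import Mathlib.Algebra.Homology.HomotopyCategory.ShiftSequence
import HarnessLib

/-!
# The Euler characteristic of a shifted cochain complex: `χ(K⟦n⟧) = (−1)ⁿ χ(K)`

Layer `Literature/Algebra/Homology` (pure linear algebra over Mathlib; proved theorems only, 0 definitions, 0 named
facts, no instances, no notation). For a cochain complex `K` of vector spaces over a division ring (Mathlib
`CochainComplex (ModuleCat K) ℤ`, shift `K⟦n⟧` with `(K⟦n⟧)ᵖ = Kᵖ⁺ⁿ`, `CochainComplex.shiftFunctor_obj_X'`) and Mathlib's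
`HomologicalComplex.eulerChar` ∕ `homologyEulerChar` (signs `Int.negOnePow`, `ComplexShape.eulerCharSignsUpInt`):

* `eulerChar_eq_negOnePow_mul_of_finrank_eq` — the reindexing lemma: if `dim Yᵖ = dim Xᵖ⁺ⁿ` for all `p` then
  `χ(Y) = (−1)ⁿ χ(X)` for `ℤ`-graded objects (`finsum_comp_equiv` along `Equiv.addRight n`, `Int.negOnePow_sub`);
* **`eulerChar_shift : (K⟦n⟧).eulerChar = n.negOnePow * K.eulerChar`**;
* **`homologyEulerChar_shift : (K⟦n⟧).homologyEulerChar = n.negOnePow * K.homologyEulerChar`** (through Mathlib's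
  `CochainComplex.ShiftSequence.shiftIso`: `H^p(K⟦n⟧) ≅ H^{p+n}(K)`);
* the transports a consumer of rows `EulerPoincareFormula` ∕ `EulerCharacteristicShortExact` ∕
  `HomologyEulerCharacteristicShortExact` needs: `finrank_shift_X`, `finrank_shift_homology`, `moduleFinite_shift_X`,
  `moduleFinite_shift_homology`, `finrankSupport_shift_X`, `finrankSupport_shift_homology`, and their finiteness.

Mathlib (pin v4.32) has no shift lemma for its `eulerChar` (`lean search 'eulerChar'`: the defining file only).
Library only (cell `pub-hodge-ring2`, count-neutral); proves nothing about any crux, route or conjecture.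

## References

* S. Lang, *Algebra* (2002), Ch. XX §3 (Euler characteristic; Euler–Poincaré maps are additive on `K₀`). [Lang2002]
* A. Hatcher, *Algebraic Topology* (2002), §2.2, Thm. 2.44. [HatcherAT2002]
-/

open CategoryTheory CategoryTheory.Limits

universe v u

namespace Literature.Algebra.Homology.EulerCharShift

variable {K : Type u} [DivisionRing K]

/-! ### Reindexing a `ℤ`-graded Euler characteristic -/

/-- **Reindexing**: if `dim Yᵖ = dim Xᵖ⁺ⁿ` for every `p`, then `χ(Y) = (−1)ⁿ · χ(X)` for Mathlib's `GradedObject.eulerChar`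
with the cochain signs `(−1)ᵖ`. [cite: Lang2002, XX §3] -/
theorem eulerChar_eq_negOnePow_mul_of_finrank_eq (X Y : GradedObject ℤ (ModuleCat.{v} K)) (n : ℤ)
    (h : ∀ p, Module.finrank K (Y p) = Module.finrank K (X (p + n))) :
    GradedObject.eulerChar (ComplexShape.up ℤ) Y = n.negOnePow * GradedObject.eulerChar (ComplexShape.up ℤ) X := by
  simp only [GradedObject.eulerChar, ComplexShape.χ, ComplexShape.eulerCharSignsUpInt_χ, h]
  rw [mul_finsum]
  conv_rhs => rw [← finsum_comp_equiv (Equiv.addRight n)]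
  refine finsum_congr fun p => ?_
  have h2 : ((n.negOnePow : ℤˣ) : ℤ) * ((n.negOnePow : ℤˣ) : ℤ) = 1 := by
    rw [← Units.val_mul, Int.units_mul_self, Units.val_one]
  simp only [Equiv.coe_addRight]
  rw [Int.negOnePow_add, Units.val_mul, ← mul_assoc, ← mul_assoc, mul_comm ((n.negOnePow : ℤˣ) : ℤ),
    mul_assoc ((p.negOnePow : ℤˣ) : ℤ), h2, mul_one]
  rfl

/-- The rank support of `Y` is the translate of that of `X` when `dim Yᵖ = dim Xᵖ⁺ⁿ`. [cite: Lang2002, XX §3] -/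
theorem finrankSupport_eq_preimage_of_finrank_eq (X Y : GradedObject ℤ (ModuleCat.{v} K)) (n : ℤ)
    (h : ∀ p, Module.finrank K (Y p) = Module.finrank K (X (p + n))) :
    GradedObject.finrankSupport Y = (fun p => p + n) ⁻¹' GradedObject.finrankSupport X := by
  ext p
  simp [GradedObject.finrankSupport, h]

/-- … hence finite when that of `X` is. [cite: Lang2002, XX §3] -/
theorem finrankSupport_finite_of_finrank_eq (X Y : GradedObject ℤ (ModuleCat.{v} K)) (n : ℤ)
    (h : ∀ p, Module.finrank K (Y p) = Module.finrank K (X (p + n))) (hX : (GradedObject.finrankSupport X).Finite) :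
    (GradedObject.finrankSupport Y).Finite := by
  rw [finrankSupport_eq_preimage_of_finrank_eq X Y n h]
  exact hX.preimage fun a _ b _ hab => by simpa using hab

/-! ### The terms of `K⟦n⟧` -/

variable (C : CochainComplex (ModuleCat.{v} K) ℤ) (n : ℤ)

/-- `dim (K⟦n⟧)ᵖ = dim Kᵖ⁺ⁿ` (the terms agree definitionally). [cite: Lang2002, XX §3] -/
theorem finrank_shift_X (p : ℤ) : Module.finrank K ((C⟦n⟧).X p) = Module.finrank K (C.X (p + n)) := rfl

/-- `(K⟦n⟧)ᵖ` is finite-dimensional when `Kᵖ⁺ⁿ` is. [cite: Lang2002, XX §3] -/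
theorem moduleFinite_shift_X (p : ℤ) [h : Module.Finite K (C.X (p + n))] : Module.Finite K ((C⟦n⟧).X p) := h

/-- The rank support of the terms of `K⟦n⟧` is the translate of that of `K`. [cite: Lang2002, XX §3] -/
theorem finrankSupport_shift_X :
    GradedObject.finrankSupport (C⟦n⟧).X = (fun p => p + n) ⁻¹' GradedObject.finrankSupport C.X :=
  finrankSupport_eq_preimage_of_finrank_eq C.X (C⟦n⟧).X n (finrank_shift_X C n)

/-- … and is finite when that of `K` is. [cite: Lang2002, XX §3] -/
theorem finrankSupport_shift_X_finite (hC : (GradedObject.finrankSupport C.X).Finite) :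
    (GradedObject.finrankSupport (C⟦n⟧).X).Finite :=
  finrankSupport_finite_of_finrank_eq C.X (C⟦n⟧).X n (finrank_shift_X C n) hC

/-- **`χ(K⟦n⟧) = (−1)ⁿ χ(K)`** for Mathlib's `HomologicalComplex.eulerChar`. [cite: Lang2002, XX §3] -/
theorem eulerChar_shift : (C⟦n⟧).eulerChar = n.negOnePow * C.eulerChar :=
  eulerChar_eq_negOnePow_mul_of_finrank_eq C.X (C⟦n⟧).X n (finrank_shift_X C n)

/-! ### The homology of `K⟦n⟧` -/

/-- `dim Hᵖ(K⟦n⟧) = dim Hᵖ⁺ⁿ(K)`, through Mathlib's `CochainComplex.ShiftSequence.shiftIso`. [cite: Lang2002, XX §3] -/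
theorem finrank_shift_homology (p : ℤ) :
    Module.finrank K ((C⟦n⟧).homology p) = Module.finrank K (C.homology (p + n)) := by
  have e : (C⟦n⟧).homology p ≅ C.homology (p + n) :=
    (CochainComplex.ShiftSequence.shiftIso (ModuleCat.{v} K) n p (p + n) (add_comm _ _)).app C
  exact LinearEquiv.finrank_eq e.toLinearEquiv

/-- `Hᵖ(K⟦n⟧)` is finite-dimensional when `Hᵖ⁺ⁿ(K)` is. [cite: Lang2002, XX §3] -/
theorem moduleFinite_shift_homology (p : ℤ) [Module.Finite K (C.homology (p + n))] :
    Module.Finite K ((C⟦n⟧).homology p) :=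
  have e : (C⟦n⟧).homology p ≅ C.homology (p + n) :=
    (CochainComplex.ShiftSequence.shiftIso (ModuleCat.{v} K) n p (p + n) (add_comm _ _)).app C
  Module.Finite.equiv e.toLinearEquiv.symm

/-- The rank support of the homology of `K⟦n⟧` is the translate of that of `K`. [cite: Lang2002, XX §3] -/
theorem finrankSupport_shift_homology :
    GradedObject.finrankSupport (fun p => (C⟦n⟧).homology p) =
      (fun p => p + n) ⁻¹' GradedObject.finrankSupport (fun p => C.homology p) :=
  finrankSupport_eq_preimage_of_finrank_eq (fun p => C.homology p) (fun p => (C⟦n⟧).homology p) n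
    (finrank_shift_homology C n)

/-- … and is finite when that of `K` is. [cite: Lang2002, XX §3] -/
theorem finrankSupport_shift_homology_finite (hC : (GradedObject.finrankSupport fun p => C.homology p).Finite) :
    (GradedObject.finrankSupport fun p => (C⟦n⟧).homology p).Finite :=
  finrankSupport_finite_of_finrank_eq (fun p => C.homology p) (fun p => (C⟦n⟧).homology p) n
    (finrank_shift_homology C n) hC

/-- **`χ_H(K⟦n⟧) = (−1)ⁿ χ_H(K)`** for Mathlib's `HomologicalComplex.homologyEulerChar`. [cite: Lang2002, XX §3] -/
theorem homologyEulerChar_shift : (C⟦n⟧).homologyEulerChar = n.negOnePow * C.homologyEulerChar :=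
  eulerChar_eq_negOnePow_mul_of_finrank_eq (fun p => C.homology p) (fun p => (C⟦n⟧).homology p) n
    (finrank_shift_homology C n)

end Literature.Algebra.Homology.EulerCharShift
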